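import Summits.BirchSwinnertonDyer.Rank1Residual.Partition.AnticyclotomicControlJSW
import Summits.BirchSwinnertonDyer.Rank1Residual.Supersingular.X6RankOneAnticyclotomicLinksClass
import HarnessLib

/-!
# THE embedding `embAt K p 𝔭` induces `𝔭`; hence JSW 2017 Thm. 3.3.1 feeds the cell's control binders
# in their ORIGINAL currency `(κ, γ, 𝔭, embAt 𝔭)` — gen 3's `hLC`, lit-cw's X6 `(CTL)` — and class X6 ∧
# {`r_an = 1`, `p ≥ 5`} gets its control link PUBLISHED (cell `b2b-bsdres`, GLUE seat gen 6;
# companion of `AnticyclotomicControlJSW.lean`)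

HONEST FRAMING (cell `b2b-bsdres`, run/shared/lean/b2b/bsd-rank1-residual/, verbatim in every
file): the goal of the cell is to DELETE the COMBINATION-SHAPED residual classes of the
Birch–Swinnerton-Dyer formula for ALL analytic-rank `≤ 1` elliptic curves over `ℚ` — "full BSD
formula for every rank `≤ 1` curve in class `C`" assembled STRICTLY from published theorems — so
that the rank-`≤ 1` remainder becomes exactly the CONSTRUCTION-SHAPED classes, which are TYPED
(missing-input `Prop`s), NOT attempted. This is not "finishing BSD". Research routes; no claim
beyond the stated classes; nothing booked; no label changes (X6 ∩ {`r_an = 1`} stays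
CONSTRUCTION-SHAPED: its typed residue is the (IMC≥∘BDP) inequality `hLA`). THEOREMS ONLY (no
definition, no named fact, no `sorry`).

## What this file records

The cell's class theorems of gens 3–5 and lit-cw's X6 theorems demand the anticyclotomic links at
the data `(κ, γ, 𝔭, embAt K p 𝔭)` — Castella's convention: the module strict at a degree-one prime
`𝔭 ∣ p` and the formal logarithm through THE embedding `K ↪ K_𝔭 = ℚ_p` at `𝔭`. The JSW fact
(`thm331_anticyclotomicControl`) speaks of an embedding `ι` and "the prime `v` induced by `ι`"
(`x ∈ v ⟺ ‖ι x‖ < 1`). §1 proves that `embAt K p 𝔭` INDUCES `𝔭`: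
`x ∈ 𝔭 ⟺ ‖embAt K p 𝔭 x‖_p < 1` for `x ∈ 𝓞 K` (the composite `K → K_𝔭 ≃ ℚ_v ≃ ℚ_p` preserves
valuations: Mathlib's `valuedAdicCompletion_eq_valuation'`, the tree's
`valued_adicCompletionEquivOfDegreeOne_symm`, and Mathlib's integer-level isomorphism
`PadicInt.adicCompletionIntegersEquiv`, units ↔ valuation `1`), i.e. `inducedPlace (embAt K p 𝔭) = 𝔭`.
Consequences:

* §2 `X11b.controlOnTreeGoodAt_of_thm331_embAt` — JSW 3.3.1 ⟹ `ControlOnTreeGoodAt p κ 𝔭 γ (embAt K p 𝔭) P`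
  (EXACTLY the shape of gen 3's `hLC` and lit-cw's `(CTL)` binders), every good `p ≥ 3`;
  `X11b.forall_controlOnTreeGoodAt_embAt_of_thm331` — for a pair `(E, p)` with `p ≥ 3` good and
  `r_an = 1`, the WHOLE binder `hLC` of lit-cw's `X6.bsdp_of_onTreeGoodLinks_of_sprung` (and, dropping
  `Odd d_K`, of gen 3's class theorems) HOLDS, granted JSW 3.3.1 + (irred_K) at the fields + GZK +
  Gross–Zagier + modularity (rank `E(K) = 1`, `#Ш(E/K)[p^∞] < ∞` and non-torsion discharged).
* §3 `Supersingular.X6.bsdp_of_thm331_of_onTreeGoodIMC_of_sprung` — lit-cw's class theorem for X6 ∧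
  {`r_an = 1`, `p ≥ 5`} with its control binder DISCHARGED: JSW 3.3.1 (PUBLISHED, no ordinarity) +
  (irred_K) `hIrrK` + the typed (IMC≥∘BDP) `hLA` at supersingular `p` (Castella–Wan Conj. 5.2-type,
  not in print) + Sprung 2024 Cor. 1.3 (ii) + GZ/Kolyvagin/Wuthrich/GZK/modularity/FH/Mazur;
  `Supersingular.RowC3.bsdp_of_goodSS_of_thm331_of_sprung` — row C3 ∩ {supersingular, `p ≥ 5`} the
  same way (an alternative to the Kobayashi-MC route of `MainConjecturesSignedRankOne.lean`).

References: [JetchevSkinnerWan2017] Thm. 3.3.1, §3.5 (3.5.d); [Castella2018] §2.2, Thm. 2.3;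
[CastellaWan2023] Conj. 5.2, Thm. 5.3; [Sprung2024] Cor. 1.3 (ii); [FrohlichTaylor1990] III §1
(1.14)(a); HOME/b2b-bsdres-lit-glue/GLUE.md GEN 6 ADDENDUM; HOME/b2b-bsdres-lit-cw/CASTELLA-WAN.md §10.
-/

set_option autoImplicit false

noncomputable section

open scoped Classical

open WeierstrassCurve NumberField IsDedekindDomain Literature.NumberTheory.EllipticCurves
  Literature.NumberTheory.EllipticCurves.ModularForms Literature.NumberTheory.Automorphic
  Literature.NumberTheory.EllipticCurves.Rank1Residual
  Literature.NumberTheory.EllipticCurves.Rank1Residual.Typed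
  Literature.NumberTheory.EllipticCurves.JetchevSkinnerWan2017

namespace Summit.BirchSwinnertonDyer.Rank1Residual

namespace X11b

/-! ### §1 `embAt K p 𝔭` induces `𝔭` -/

section EmbAt

variable {K : Type} [Field K] [NumberField K] {p : ℕ} [hp : Fact p.Prime]

/-- **THE embedding at `𝔭` induces `𝔭`**: for a degree-one prime `𝔭 ∣ p` of `𝓞 K` and `x ∈ 𝓞 K`,
`x ∈ 𝔭 ⟺ ‖embAt K p 𝔭 x‖_p < 1`. The composite `K → K_𝔭 ≃+* ℚ_v ≃ ℚ_p` (`embAt`) carries the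
`𝔭`-adic valuation of `x` (`valuedAdicCompletion_eq_valuation'`, `valuation_lt_one_iff_mem`)
unchanged through the tree's degree-one isomorphism (`valued_adicCompletionEquivOfDegreeOne_symm`)
and through Mathlib's `Padic.adicCompletionEquiv`, whose restriction to integers is the ring
isomorphism `PadicInt.adicCompletionIntegersEquiv` (`coe_adicCompletionIntegersEquiv_symm_apply`):
an integer has norm `< 1` iff it is a non-unit (`PadicInt.mem_nonunits`) iff its image is a non-unit
iff its valuation is `< 1` (`ValuationSubring.valuation_eq_one_iff`).
[cite: FrohlichTaylor1990, Ch. III §1 (1.14)(a)] [cite: CastellaGrossiLeeSkinner2022, §2 (arXiv v2 TeX L479: "`v` the prime of `K` above `p` induced by `ι_p`")] -/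
theorem mem_asIdeal_iff_norm_embAt_lt_one (𝔭 : HeightOneSpectrum (𝓞 K))
    (h𝔭 : ((p : ℕ) : 𝓞 K) ∈ 𝔭.asIdeal) (he : 𝔭.asIdeal.ramificationIdx (𝓞 ℚ) = 1)
    (hf : 𝔭.asIdeal.inertiaDeg (𝓞 ℚ) = 1) (x : 𝓞 K) :
    x ∈ 𝔭.asIdeal ↔ ‖embAt K p 𝔭 h𝔭 he hf (x : K)‖ < 1 := by
  -- (1) membership ↔ valuation of the image in `K_𝔭`
  have h1 : x ∈ 𝔭.asIdeal ↔ Valued.v (algebraMap K (𝔭.adicCompletion K) (x : K)) < 1 := by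
    rw [← HeightOneSpectrum.valuation_lt_one_iff_mem (K := K) 𝔭 x]
    rw [show algebraMap K (𝔭.adicCompletion K) (x : K) = ((x : K) : 𝔭.adicCompletion K) from rfl,
      HeightOneSpectrum.valuedAdicCompletion_eq_valuation']
  -- (2) transport along `K_𝔭 ≃+* ℚ_v` (valuation preserving)
  set z : 𝔭.adicCompletion K := algebraMap K (𝔭.adicCompletion K) (x : K) with hz
  haveI : 𝔭.asIdeal.LiesOver (ratPlace p).asIdeal := ⟨by rw [← under_eq_ratPlace_of_mem h𝔭]; rfl⟩
  set e1 := adicCompletionEquivOfDegreeOne ℚ K (ratPlace p) 𝔭 he hf with he1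
  set z' : (ratPlace p).adicCompletion ℚ := e1.symm z with hz'
  have h2 : Valued.v z' = Valued.v z :=
    valued_adicCompletionEquivOfDegreeOne_symm ℚ K (ratPlace p) 𝔭 he hf z
  have hzint : Valued.v z ≤ 1 := by
    rw [hz, show algebraMap K (𝔭.adicCompletion K) (x : K) = ((x : K) : 𝔭.adicCompletion K) from rfl,
      HeightOneSpectrum.valuedAdicCompletion_eq_valuation']
    exact HeightOneSpectrum.valuation_le_one 𝔭 x
  have hz'int : z' ∈ (ratPlace p).adicCompletionIntegers ℚ := by
    rw [HeightOneSpectrum.mem_adicCompletionIntegers, h2]; exact hzint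
  have hz'le : Valued.v z' ≤ 1 := by rw [h2]; exact hzint
  -- (3) transport along `ℚ_v ≃ ℚ_p` through the integer-level isomorphism
  set e2 := Padic.adicCompletionEquiv (𝓞 ℚ) ⟨p, hp.out⟩ with he2
  have hemb : embAt K p 𝔭 h𝔭 he hf (x : K) = e2.symm z' := rfl
  set Z' : (ratPlace p).adicCompletionIntegers ℚ := ⟨z', hz'int⟩ with hZ'
  have hY : (((PadicInt.adicCompletionIntegersEquiv (𝓞 ℚ) ⟨p, hp.out⟩).symm Z' : ℤ_[p]) : ℚ_[p]) =
      e2.symm z' := PadicInt.coe_adicCompletionIntegersEquiv_symm_apply (𝓞 ℚ) ⟨p, hp.out⟩ Z'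
  -- units of `𝒪_v` are the elements of valuation `1`
  have hunit : IsUnit Z' ↔ Valued.v z' = 1 := by
    rw [ValuationSubring.valuation_eq_one_iff]
    exact ((Valuation.isEquiv_valuation_valuationSubring
      (Valued.v (R := (ratPlace p).adicCompletion ℚ))).eq_one_iff_eq_one).symm
  rw [h1, hemb, ← hY, ← PadicInt.norm_def, ← PadicInt.mem_nonunits, mem_nonunits_iff,
    MulEquiv.isUnit_map, ← h2]
  constructor
  · intro h hu
    exact h.ne (hunit.mp hu)
  · intro h
    exact lt_of_le_of_ne hz'le fun h' ↦ h (hunit.mpr h')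

/-- **`inducedPlace (embAt K p 𝔭) = 𝔭`**: the prime induced by THE embedding at a degree-one `𝔭 ∣ p`
(lit-cgls's `inducedPlace`, CGLS 2022 §2) is `𝔭` itself. [cite: CastellaGrossiLeeSkinner2022, §2 (arXiv v2 TeX L479)]
[cite: Castella2018, §2.2 (arXiv:1704.06608 p. 5)] -/
theorem inducedPlace_embAt (𝔭 : HeightOneSpectrum (𝓞 K)) (h𝔭 : ((p : ℕ) : 𝓞 K) ∈ 𝔭.asIdeal)
    (he : 𝔭.asIdeal.ramificationIdx (𝓞 ℚ) = 1) (hf : 𝔭.asIdeal.inertiaDeg (𝓞 ℚ) = 1) :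
    inducedPlace (embAt K p 𝔭 h𝔭 he hf) = 𝔭 := by
  apply HeightOneSpectrum.ext
  ext x
  rw [mem_inducedPlace_iff, ← mem_asIdeal_iff_norm_embAt_lt_one 𝔭 h𝔭 he hf x]

end EmbAt

/-! ### §2 (CTL)ᵍ from JSW 3.3.1 at `(κ, γ, 𝔭, embAt 𝔭)` — the cell's original currency -/

section Control

variable {W : WeierstrassCurve ℚ} [W.IsElliptic] [W.IsGloballyMinimal] {p : ℕ} [Fact p.Prime]
  {K : Type} [Field K] [NumberField K]

/-- **`ControlOnTreeGoodAt p κ 𝔭 γ (embAt K p 𝔭) P` FROM JSW 2017 Thm. 3.3.1** at a degree-one prime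
`𝔭 ∣ p` (good `p ≥ 3`, ordinary or supersingular, anomalous allowed; `K` imaginary quadratic with `p`
and every `ℓ ∣ N` split; `E[p]` irreducible over `K`; `rank_ℤ E(K) = 1`, `#Ш(E/K)[p^∞] < ∞`, `P` of
infinite order): §1 supplies the binder "`𝔭` is the prime induced by `embAt K p 𝔭`".
[cite: JetchevSkinnerWan2017, Thm. 3.3.1 with §3.5 (3.5.d) (arXiv:1512.06894 pp. 11, 16)]
[cite: Castella2018, Thm. 2.3 (arXiv:1704.06608 p. 5)] -/
theorem controlOnTreeGoodAt_of_thm331_embAt (h331 : thm331_anticyclotomicControl) (hp : 3 ≤ p)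
    (hgood : Good W p) (hK : IsImaginaryQuadratic K) (hHp : SatisfiesHeegnerHypothesis p K)
    {N : ℕ} (hN : W.conductorNorm ℤ = N) (hHN : SatisfiesHeegnerHypothesis N K)
    (hirrK : (W.baseChange K).HasIrreducibleModPGaloisRep p)
    (κ : ZpExtension K p) (hκ : κ.IsAnticyclotomic)
    (γ : Field.absoluteGaloisGroup K) [Fact (κ.IsTopGenerator γ)]
    (𝔭 : HeightOneSpectrum (𝓞 K)) (h𝔭 : ((p : ℕ) : 𝓞 K) ∈ 𝔭.asIdeal)
    (he : 𝔭.asIdeal.ramificationIdx (𝓞 ℚ) = 1) (hf : 𝔭.asIdeal.inertiaDeg (𝓞 ℚ) = 1)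
    (hrk : (W.baseChange K).mordellWeilRank = 1)
    (hfin : Finite (AddCommGroup.primaryComponent (W.baseChange K).sha p))
    (P : (W.baseChange K).toAffine.Point) (hP : ¬ IsOfFinAddOrder P) :
    ControlOnTreeGoodAt p κ 𝔭 γ (embAt K p 𝔭 h𝔭 he hf) P :=
  controlOnTreeGoodAt_of_thm331 h331 hp hgood hK hHp hN hHN hirrK (embAt K p 𝔭 h𝔭 he hf) 𝔭
    (mem_asIdeal_iff_norm_embAt_lt_one 𝔭 h𝔭 he hf) κ hκ γ hrk hfin P hP

variable (W p) in
/-- **The WHOLE control binder of a rank-one pair, in the cell's original currency, HOLDS — granted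
JSW 3.3.1.** For `W/ℚ` globally minimal with `ord_{s=1} L(E,s) = 1` and `p ≥ 3` of good reduction
(ordinary or supersingular): at every classical Heegner datum of the pair (level `N = N_E`, `K`
imaginary quadratic with `d_K < −4`, every `ℓ ∣ N` and `p` split, `L(E^{d_K},1) ≠ 0`, a Manin-unit
parametrisation datum and its Heegner point `P`, non-torsion), every anticyclotomic `κ`, generator `γ`
and degree-one `𝔭 ∋ p`, the link `ControlOnTreeGoodAt p κ 𝔭 γ (embAt K p 𝔭) P` holds. Inputs: the
named facts `h331` (JSW Thm. 3.3.1), `hGZK` and the typed (irred_𝒦) `hIrrK` at the fields;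
`rank_ℤ E(K) = 1` and `#Ш(E/K)[p^∞] < ∞` come from GZK for `E` and `E^{d_K}`
(`mordellWeilRank_baseChange_eq_one_and_finite_sha_of_twist_L_one_ne_zero`); non-torsion of `P` is
part of the binder. This is EXACTLY the
binder `hLC` of lit-cw's `Supersingular.X6.bsdp_of_onTreeGoodLinks_of_sprung` (and, with `Odd d_K`
dropped, of gen 3's class theorems). [cite: JetchevSkinnerWan2017, Thm. 3.3.1 with §3.5 (3.5.d), §7.4.1]
[cite: GrossLMS1991, Thm. 1.3] -/
theorem forall_controlOnTreeGoodAt_embAt_of_thm331 (h331 : thm331_anticyclotomicControl)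
    (hGZK : rank_eq_analyticRank_of_analyticRank_le_one)
    (hp : 3 ≤ p) (hgood : Good W p) (hr : W.analyticRank = 1)
    (hIrrK : ∀ (K : Type) [Field K] [NumberField K], IsImaginaryQuadratic K →
      SatisfiesHeegnerHypothesis (W.conductorNorm ℤ) K → SatisfiesHeegnerHypothesis p K →
      (W.baseChange K).HasIrreducibleModPGaloisRep p) :
    ∀ (N : ℕ) [NeZero N] (K : Type) [Field K] [NumberField K]
      (Dt : ModularParametrizationData W N) (H : HeegnerDatum N (NumberField.discr K)) (ι : K →+* ℂ)
      (P : (W.baseChange K).toAffine.Point),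
      W.conductorNorm ℤ = N → IsImaginaryQuadratic K → NumberField.discr K < -4 →
      SatisfiesHeegnerHypothesis N K → SatisfiesHeegnerHypothesis p K →
      (W.quadraticTwist (NumberField.discr K : ℚ)).entireLFunction 1 ≠ 0 →
      WeierstrassCurve.Affine.Point.map ι.toRatAlgHom P = heegnerPointComplex Dt H →
      ¬ (p : ℤ) ∣ Dt.c → ¬ IsOfFinAddOrder P →
      ∀ (κ : ZpExtension K p), κ.IsAnticyclotomic →
        ∀ (γ : Field.absoluteGaloisGroup K) [Fact (κ.IsTopGenerator γ)]
          (𝔭 : HeightOneSpectrum (𝓞 K)) (h𝔭 : ((p : ℕ) : 𝓞 K) ∈ 𝔭.asIdeal)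
          (he : 𝔭.asIdeal.ramificationIdx (𝓞 ℚ) = 1) (hf : 𝔭.asIdeal.inertiaDeg (𝓞 ℚ) = 1),
          ControlOnTreeGoodAt p κ 𝔭 γ (embAt K p 𝔭 h𝔭 he hf) P := by
  intro N _ K _ _ Dt H ι P hN hK _ hHN hHp hLt _ _ hPinf κ hκ γ _ 𝔭 h𝔭 he hf
  obtain ⟨hrQ, hShaQ⟩ := hGZK W hr.le
  rw [hr] at hrQ
  obtain ⟨hrk, hfin⟩ :=
    mordellWeilRank_baseChange_eq_one_and_finite_sha_of_twist_L_one_ne_zero hGZK W K hK p hrQ hShaQ hLt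
  exact controlOnTreeGoodAt_of_thm331_embAt h331 hp hgood hK hHp hN hHN (hIrrK K hK (hN ▸ hHN) hHp)
    κ hκ γ 𝔭 h𝔭 he hf hrk hfin P hPinf

end Control

end X11b

/-! ### §3 Class X6 ∧ {`r_an = 1`, `p ≥ 5`} and row C3 ∩ {supersingular}: the control link PUBLISHED -/

namespace Supersingular

open Literature.NumberTheory.EllipticCurves.Wuthrich2014

variable (W : WeierstrassCurve ℚ) [W.IsElliptic] [W.IsGloballyMinimal] (p : ℕ) [Fact p.Prime]

/-- **`BSD(E,p)` on X6 ∧ {r_an = 1} ∧ {p ≥ 5} with the control link PUBLISHED** — lit-cw's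
`X6.bsdp_of_onTreeGoodLinks_of_sprung` with its binder `hLC` DISCHARGED by Jetchev–Skinner–Wan 2017
Thm. 3.3.1 (`h331`; no ordinarity hypothesis, so it applies at the supersingular `p`) through
`X11b.forall_controlOnTreeGoodAt_embAt_of_thm331`, at the price of JSW's hypothesis (irred_𝒦) at the
Heegner fields (`hIrrK`; in print ⇐ (irr) + (ram), Skinner 2020 Lemma 2.8.1 — X6 is semistable with
`E[p]` irreducible). The remaining typed input is `hLA` = (IMC≥∘BDP) at the supersingular `p`
(Castella–Wan Conj. 5.2 ∘ Brooks on the constructed `X_ac`; NOT in print — X6 ∩ {`r_an = 1`} stays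
CONSTRUCTION-SHAPED); the upper half is Sprung 2024 Cor. 1.3 (ii) (`hS`).
[cite: JetchevSkinnerWan2017, Thm. 3.3.1 with §3.5 (3.5.d), §7.4.1] [cite: Sprung2024, Cor. 1.3 (p. 5), second sentence]
[cite: CastellaWan2023, Conj. 5.2, Thm. 5.3 (MS p. 23)] [cite: Skinner2020, Lemma 2.8.1 (§2.8)] [cite: Miller2011LMS, Def. 1.1] -/
theorem X6.bsdp_of_thm331_of_onTreeGoodIMC_of_sprung
    (hGZ : ∀ (N : ℕ) [NeZero N] (W : WeierstrassCurve ℚ) (K : Type) [Field K] [NumberField K],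
      gross_zagier N W K)
    (hKo : ∀ (N : ℕ) [NeZero N] (W : WeierstrassCurve ℚ) (K : Type) [Field K] [NumberField K],
      kolyvagin N W K)
    (hWu : sha_dvd_analyticSha) (hS : Sprung2024.cor13_padicValRat_bsd_rank_one_le)
    (h331 : thm331_anticyclotomicControl)
    (hGZK : rank_eq_analyticRank_of_analyticRank_le_one) (hmod : hasEntireLFunction_rat)
    (hnf : exists_isNewformOf)
    (hFH : friedbergHoffstein_exists_heegnerField_split_twist_ne_zero)
    (hMaz : mazur_not_dvd_maninConstant_of_odd)
    (hX : ClassX6 W p) (hp5 : 5 ≤ p) (hr : W.analyticRank = 1)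
    (hIrrK : ∀ (K : Type) [Field K] [NumberField K], IsImaginaryQuadratic K →
      SatisfiesHeegnerHypothesis (W.conductorNorm ℤ) K → SatisfiesHeegnerHypothesis p K →
      (W.baseChange K).HasIrreducibleModPGaloisRep p)
    (hLA : ∀ (N : ℕ) [NeZero N] (K : Type) [Field K] [NumberField K]
      (Dt : ModularParametrizationData W N) (H : HeegnerDatum N (NumberField.discr K)) (ι : K →+* ℂ)
      (P : (W.baseChange K).toAffine.Point),
      W.conductorNorm ℤ = N → IsImaginaryQuadratic K → NumberField.discr K < -4 →
      SatisfiesHeegnerHypothesis N K → SatisfiesHeegnerHypothesis p K →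
      (W.quadraticTwist (NumberField.discr K : ℚ)).entireLFunction 1 ≠ 0 →
      WeierstrassCurve.Affine.Point.map ι.toRatAlgHom P = heegnerPointComplex Dt H →
      ¬ (p : ℤ) ∣ Dt.c → ¬ IsOfFinAddOrder P →
      ∀ (κ : ZpExtension K p), κ.IsAnticyclotomic →
        ∀ (γ : Field.absoluteGaloisGroup K) [Fact (κ.IsTopGenerator γ)]
          (𝔭 : HeightOneSpectrum (𝓞 K)) (h𝔭 : ((p : ℕ) : 𝓞 K) ∈ 𝔭.asIdeal)
          (he : 𝔭.asIdeal.ramificationIdx (𝓞 ℚ) = 1) (hf : 𝔭.asIdeal.inertiaDeg (𝓞 ℚ) = 1),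
          X11b.IMCLowerWaldspurgerOnTreeGoodAt p κ 𝔭 γ (X11b.embAt K p 𝔭 h𝔭 he hf) P) :
    BSDp W p :=
  X6.bsdp_of_onTreeGoodLinks_of_sprung hGZ hKo hWu hS hGZK hmod hnf hFH hMaz W p hX hp5 hr
    (X11b.forall_controlOnTreeGoodAt_embAt_of_thm331 W p h331 hGZK (by omega) hX.1.1 hr hIrrK)
    hLA

/-- **Row C3 ∩ {supersingular, `p ≥ 5`} with the control link PUBLISHED**: such a pair is an X6 pair
with `r_an = 1`; `BSD(E,p)` from JSW 3.3.1 (control, published) + (irred_K) `hIrrK` + the typed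
(IMC≥∘BDP) `hLA` at the supersingular `p` + Sprung Cor. 1.3 (ii) — an alternative, on this sub-row,
to the Kobayashi-main-conjecture route of `RowC3.bsdp_rankOne_ss_of_kobayashiMainConjecture_of_corA5`.
[cite: JetchevSkinnerWan2017, Thm. 1.2.1, Thm. 3.3.1, §7.4.1] [cite: Sprung2024, Cor. 1.3 (p. 5), second sentence]
[cite: CastellaWan2023, Conj. 5.2, Thm. 5.3 (MS p. 23)] -/
theorem RowC3.bsdp_of_goodSS_of_thm331_of_sprung
    (hGZ : ∀ (N : ℕ) [NeZero N] (W : WeierstrassCurve ℚ) (K : Type) [Field K] [NumberField K],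
      gross_zagier N W K)
    (hKo : ∀ (N : ℕ) [NeZero N] (W : WeierstrassCurve ℚ) (K : Type) [Field K] [NumberField K],
      kolyvagin N W K)
    (hWu : sha_dvd_analyticSha) (hS : Sprung2024.cor13_padicValRat_bsd_rank_one_le)
    (h331 : thm331_anticyclotomicControl)
    (hGZK : rank_eq_analyticRank_of_analyticRank_le_one) (hmod : hasEntireLFunction_rat)
    (hnf : exists_isNewformOf)
    (hFH : friedbergHoffstein_exists_heegnerField_split_twist_ne_zero)
    (hMaz : mazur_not_dvd_maninConstant_of_odd)
    (h : RowC3 W p) (hss : GoodSS W p) (hp5 : 5 ≤ p)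
    (hIrrK : ∀ (K : Type) [Field K] [NumberField K], IsImaginaryQuadratic K →
      SatisfiesHeegnerHypothesis (W.conductorNorm ℤ) K → SatisfiesHeegnerHypothesis p K →
      (W.baseChange K).HasIrreducibleModPGaloisRep p)
    (hLA : ∀ (N : ℕ) [NeZero N] (K : Type) [Field K] [NumberField K]
      (Dt : ModularParametrizationData W N) (H : HeegnerDatum N (NumberField.discr K)) (ι : K →+* ℂ)
      (P : (W.baseChange K).toAffine.Point),
      W.conductorNorm ℤ = N → IsImaginaryQuadratic K → NumberField.discr K < -4 →
      SatisfiesHeegnerHypothesis N K → SatisfiesHeegnerHypothesis p K →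
      (W.quadraticTwist (NumberField.discr K : ℚ)).entireLFunction 1 ≠ 0 →
      WeierstrassCurve.Affine.Point.map ι.toRatAlgHom P = heegnerPointComplex Dt H →
      ¬ (p : ℤ) ∣ Dt.c → ¬ IsOfFinAddOrder P →
      ∀ (κ : ZpExtension K p), κ.IsAnticyclotomic →
        ∀ (γ : Field.absoluteGaloisGroup K) [Fact (κ.IsTopGenerator γ)]
          (𝔭 : HeightOneSpectrum (𝓞 K)) (h𝔭 : ((p : ℕ) : 𝓞 K) ∈ 𝔭.asIdeal)
          (he : 𝔭.asIdeal.ramificationIdx (𝓞 ℚ) = 1) (hf : 𝔭.asIdeal.inertiaDeg (𝓞 ℚ) = 1),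
          X11b.IMCLowerWaldspurgerOnTreeGoodAt p κ 𝔭 γ (X11b.embAt K p 𝔭 h𝔭 he hf) P) :
    BSDp W p := by
  obtain ⟨hr, hsst, -, -, -⟩ := h
  exact X6.bsdp_of_thm331_of_onTreeGoodIMC_of_sprung W p hGZ hKo hWu hS h331 hGZK hmod hnf hFH hMaz
    ⟨hss, hsst, Or.inl hp5⟩ hp5 hr hIrrK hLA

end Supersingular

end Summit.BirchSwinnertonDyer.Rank1Residual

end
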